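import Literature.Geometry.Lorentzian.ChartSecondFundamentalForm
import Literature.Geometry.Lorentzian.Basic
import HarnessLib

/-!
# `KerrShieldedDataExist`, line `plug-the-second-sheet` (skeleton v4 "KerrCap") — stub `stub_capFarK`, I:
# the second fundamental form of a slice transverse to a Killing translation, in coordinates

Support file (`--supports stmt-FinalStateConjecture-10055`; everything proved, no definitions, no named facts)
for the registered stub `stub_capFarK` of `Cruxes/KerrShieldedDataExist/Lines/plug_the_second_sheet.lean`.

Chart-generic identity behind "`K_{ij} = (2N)⁻¹(∇_i β_j + ∇_j β_i)` for a stationary metric"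
(Wald 1984, (10.2.13) with (E.2.30); Bartnik–Isenberg 2004, §2 and (4.11)): let `g` be a metric on a chart
domain `V ⊆ E` with components `G` invariant under the translations by a constant vector `T`
(`∂_T G = 0` at the point), `f : U → V` a map from a chart domain `U ⊆ E'` with representative `Φ`,
and suppose the normal representative splits the Killing vector along the image,
`N = m (T − DΦ(b))` near `y` for a scalar `m` and a vector field `b` on `U` (the shift pulled back to
the parameter domain), with `T − DΦ(y)(b y) ⊥ DΦ(y)(E')`. Then (`KerrCap.secondFundamentalForm_add_swap_eq`)

  `K_ν(v, w) + K_ν(w, v) = −m(y) · (∂_{b}[G(Φ)(DΦ v, DΦ w)](y) + h(Db(y) v, w) + h(v, Db(y) w))`,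

`h(v, w) = G(Φ y)(DΦ(y) v, DΦ(y) w)` the induced form: the right-hand side is `−m · (𝓛_b h)(v, w)`. Proof:
the coordinate formula `K_ν(v, w) = G(DN v + Γ(N)(DΦ v), DΦ w)` (`OpensChart.secondFundamentalForm_eq_of_repr`),
`G(Γ(N)X, Y) = ½ Kos(N; X, Y)` (`OpensChart.val_christoffel_const`), the Leibniz rule for
`N = m (T − DΦ(b))`, symmetry of `D²Φ(y)`, and the Killing property `∂_T G = 0`, which kills the
symmetric part of `Kos(T; ·, ·)`.

References: Wald 1984, §10.2 and App. E.2; Bartnik–Isenberg, *The constraint equations* (2004), §2;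
O'Neill 1983, Ch. 3, Prop. 3.13 and Ch. 4, Lemma 4.1.
-/

-- the doubled `FinalStateConjecture` path component is the summit/problem naming scheme, not a mistake
set_option linter.dupNamespace false
-- iterated operator-norm spaces (values of `DG`, `D²Φ`): nested instance problems, as in `CoordTensorCovariance.lean`
set_option maxSynthPendingDepth 3

noncomputable section

open Set Function Filter Topology TopologicalSpace
open scoped Manifold ContDiff Topology

open Literature.Geometry.Lorentzian

namespace Summit.FinalStateConjecture.FinalStateConjecture.Theorems.SwallowTheDatum

namespace KerrCap

section Killing

variable {E : Type*} [NormedAddCommGroup E] [NormedSpace ℝ E] [FiniteDimensional ℝ E]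
  {E' : Type*} [NormedAddCommGroup E'] [NormedSpace ℝ E'] [FiniteDimensional ℝ E']
  {V : Opens E} {U : Opens E'}
  {g : PseudoRiemannianMetric 𝓘(ℝ, E) ∞ E (TangentSpace 𝓘(ℝ, E) : V → Type _)}
  {G : E → E →L[ℝ] E →L[ℝ] ℝ}

omit [FiniteDimensional ℝ E] in
/-- Derivatives of symmetric components are symmetric: `DG(x)(X)(Y, Z) = DG(x)(X)(Z, Y)`. [folklore] -/
theorem fderiv_repr_symm (hGsymm : ∀ x (X Y : E), G x X Y = G x Y X) {x : E} (hGd : DifferentiableAt ℝ G x)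
    (X Y Z : E) : fderiv ℝ G x X Y Z = fderiv ℝ G x X Z Y := by
  rw [← OpensChart.fderiv_apply₂ G hGd Y Z X, ← OpensChart.fderiv_apply₂ G hGd Z Y X]
  have h : (fun y ↦ G y Y Z) = fun y ↦ G y Z Y := funext fun y ↦ hGsymm y Y Z
  rw [h]

omit [FiniteDimensional ℝ E] [FiniteDimensional ℝ E'] in
/-- **The derivative of the induced form along the parameter domain**: for `Φ` of class `C²` at `y` and
`G` differentiable at `Φ y`, the function `z ↦ G(Φ z)(DΦ(z) v, DΦ(z) w)` has derivative
`X ↦ DG(Φ y)(DΦ X)(DΦ v, DΦ w) + G(Φ y)(D²Φ(X, v), DΦ w) + G(Φ y)(DΦ v, D²Φ(X, w))` at `y`. [folklore] -/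
theorem hasFDerivAt_inducedRepr {Φ : E' → E} {y : E'} (hΦ : ContDiffAt ℝ 2 Φ y)
    (hGd : DifferentiableAt ℝ G (Φ y)) (v w : E') :
    HasFDerivAt (fun z ↦ G (Φ z) (fderiv ℝ Φ z v) (fderiv ℝ Φ z w))
      ((G (Φ y) (fderiv ℝ Φ y v)).comp ((fderiv ℝ (fderiv ℝ Φ) y).flip w) +
        ((G (Φ y)).comp ((fderiv ℝ (fderiv ℝ Φ) y).flip v) +
          ((fderiv ℝ G (Φ y)).comp (fderiv ℝ Φ y)).flip (fderiv ℝ Φ y v)).flip (fderiv ℝ Φ y w)) y := by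
  have hΦd : DifferentiableAt ℝ Φ y := hΦ.differentiableAt (by simp)
  have hDΦ : DifferentiableAt ℝ (fderiv ℝ Φ) y :=
    (hΦ.fderiv_right (m := 1) (by norm_num)).differentiableAt (by simp)
  have hGΦ : HasFDerivAt (fun z ↦ G (Φ z)) ((fderiv ℝ G (Φ y)).comp (fderiv ℝ Φ y)) y :=
    hGd.hasFDerivAt.comp y hΦd.hasFDerivAt
  have hA : ∀ u : E', HasFDerivAt (fun z ↦ fderiv ℝ Φ z u) ((fderiv ℝ (fderiv ℝ Φ) y).flip u) y := by
    intro u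
    have h := hDΦ.hasFDerivAt.clm_apply (hasFDerivAt_const u y)
    simpa using h
  have h1 := hGΦ.clm_apply (hA v)
  exact h1.clm_apply (hA w)

/-- **The second fundamental form of a slice whose normal splits a Killing translation** (chart form of
`K_{ij} = (2N)⁻¹(∇_i β_j + ∇_j β_i)` for stationary metrics). Let `g` be a `C^∞` metric on the chart domain
`V ⊆ E` with symmetric components `G`, `f : U → V` (`U ⊆ E'` a chart domain) with representative `Φ` of class
`C²` at `y`, and `ν` a field along `f` whose representative is `N = m · (T − DΦ(b))` near `y`, where `T ∈ E`
is a constant vector with `∂_T G(Φ y) = 0` (Killing translation), `m` a scalar and `b` a vector field on the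
parameter domain, both differentiable at `y`, and `T − DΦ(y)(b y)` is `G(Φ y)`-orthogonal to `DΦ(y)(E')`.
Then `K_ν(v, w) + K_ν(w, v) = −m(y) (∂_{b(y)}[G(Φ)(DΦ v, DΦ w)] + h(Db(y)v, w) + h(v, Db(y)w))`,
`h = G(Φ y)(DΦ ·, DΦ ·)`, i.e. `−m · 𝓛_b h (v, w)`. Wald 1984, (10.2.13) and (E.2.30); Bartnik–Isenberg 2004,
§2; the coordinate formula is O'Neill 1983, Ch. 4, Lemma 4.1 with Ch. 3, Prop. 3.13.
[cite: Wald1984, (10.2.13)] [cite: ONeill1983, Ch. 4, Lemma 4.1] -/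
theorem secondFundamentalForm_add_swap_eq [g.HasLeviCivita] (hG : ∀ x : V, g.val x = G x)
    (hGsymm : ∀ x (X Y : E), G x X Y = G x Y X) {f : U → V} {Φ : E' → E}
    (hf : ∀ y : U, (f y : E) = Φ y) {ν : NormalField 𝓘(ℝ, E) f} {N : E' → E}
    (hν : ∀ y : U, ν y = N y) {y : U} {T : E} {m : E' → ℝ} {b : E' → E'}
    (hΦ : ContDiffAt ℝ 2 Φ y) (hm : DifferentiableAt ℝ m y) (hb : DifferentiableAt ℝ b y)
    (hN : N =ᶠ[𝓝 (y : E')] fun z ↦ m z • (T - fderiv ℝ Φ z (b z)))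
    (hGd : DifferentiableAt ℝ G (Φ y)) (hT : fderiv ℝ G (Φ y) T = 0)
    (hnormal : ∀ w : E', G (Φ y) (T - fderiv ℝ Φ y (b y)) (fderiv ℝ Φ y w) = 0) (v w : E') :
    g.secondFundamentalForm 𝓘(ℝ, E') f ν y v w + g.secondFundamentalForm 𝓘(ℝ, E') f ν y w v =
      -(m y * (fderiv ℝ (fun z ↦ G (Φ z) (fderiv ℝ Φ z v) (fderiv ℝ Φ z w)) y (b y) +
        G (Φ y) (fderiv ℝ Φ y (fderiv ℝ b y v)) (fderiv ℝ Φ y w) +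
        G (Φ y) (fderiv ℝ Φ y v) (fderiv ℝ Φ y (fderiv ℝ b y w)))) := by
  have hΦd : DifferentiableAt ℝ Φ y := hΦ.differentiableAt (by simp)
  have hDΦ : DifferentiableAt ℝ (fderiv ℝ Φ) y :=
    (hΦ.fderiv_right (m := 1) (by norm_num)).differentiableAt (by simp)
  -- the field `B z = DΦ(z)(b z)` and the explicit normal representative
  have hB : HasFDerivAt (fun z ↦ fderiv ℝ Φ z (b z))
      ((fderiv ℝ Φ y).comp (fderiv ℝ b y) + (fderiv ℝ (fderiv ℝ Φ) y).flip (b y)) y :=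
    hDΦ.hasFDerivAt.clm_apply hb.hasFDerivAt
  have hN' : HasFDerivAt (fun z ↦ m z • (T - fderiv ℝ Φ z (b z)))
      (m y • ((0 : E' →L[ℝ] E) - ((fderiv ℝ Φ y).comp (fderiv ℝ b y) + (fderiv ℝ (fderiv ℝ Φ) y).flip (b y))) +
        (fderiv ℝ m y).smulRight (T - fderiv ℝ Φ y (b y))) y :=
    hm.hasFDerivAt.smul ((hasFDerivAt_const T (y : E')).sub hB)
  have hNd : DifferentiableAt ℝ N y := hN'.differentiableAt.congr_of_eventuallyEq hN
  have hNy : N y = m y • (T - fderiv ℝ Φ y (b y)) := hN.eq_of_nhds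
  have hDN : fderiv ℝ N y = m y • ((0 : E' →L[ℝ] E) - ((fderiv ℝ Φ y).comp (fderiv ℝ b y) +
      (fderiv ℝ (fderiv ℝ Φ) y).flip (b y))) + (fderiv ℝ m y).smulRight (T - fderiv ℝ Φ y (b y)) := by
    rw [hN.fderiv_eq, hN'.fderiv]
  -- the coordinate formula, twice
  have hGf : DifferentiableAt ℝ G (f y) := by rw [hf]; exact hGd
  rw [OpensChart.secondFundamentalForm_eq_of_repr hG hf hν hΦd hNd hGf v w,
    OpensChart.secondFundamentalForm_eq_of_repr hG hf hν hΦd hNd hGf w v]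
  have hvalF : (g.val (f y) : E →L[ℝ] E →L[ℝ] ℝ) = G (Φ y) := by rw [hG, hf]
  have hval : ∀ X W : E, g.val (f y) X W = G (Φ y) X W := fun X W ↦
    DFunLike.congr_fun (DFunLike.congr_fun hvalF X) W
  have hΓ : ∀ X W : E, G (Φ y) (OpensChart.christoffel g G (f y) (N y) X) W =
      2⁻¹ * (fderiv ℝ G (Φ y) X (N y) W + fderiv ℝ G (Φ y) (N y) W X - fderiv ℝ G (Φ y) W X (N y)) := by
    intro X W
    rw [← hval, OpensChart.val_christoffel_const (g := g) (G := G), OpensChart.koszulForm_apply, hf]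
  rw [hval, hval, map_add, _root_.add_apply, map_add, _root_.add_apply, hΓ, hΓ, hDN,
    hNy]
  -- the derivative of the induced form along `b y`
  rw [(hasFDerivAt_inducedRepr hΦ hGd v w).fderiv]
  -- symmetric second derivative, symmetric components, Killing translation
  have hsym := hΦ.isSymmSndFDerivAt (by simp)
  have s1 : fderiv ℝ (fderiv ℝ Φ) y v (b y) = fderiv ℝ (fderiv ℝ Φ) y (b y) v := hsym.eq v (b y)
  have s2 : fderiv ℝ (fderiv ℝ Φ) y w (b y) = fderiv ℝ (fderiv ℝ Φ) y (b y) w := hsym.eq w (b y)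
  have hS := fderiv_repr_symm hGsymm hGd
  simp only [_root_.add_apply, _root_.sub_apply, FunLike.coe_smul,
    Pi.smul_apply, ContinuousLinearMap.comp_apply, ContinuousLinearMap.flip_apply,
    ContinuousLinearMap.smulRight_apply, map_add, map_sub, map_smul, smul_eq_mul, zero_sub, map_neg,
    _root_.neg_apply, hT, s1, s2]
  have n1 := hnormal w
  have n2 := hnormal v
  simp only [map_sub, _root_.sub_apply] at n1 n2
  have e1 := hS (fderiv ℝ Φ y v) T (fderiv ℝ Φ y w)
  have e2 := hS (fderiv ℝ Φ y w) T (fderiv ℝ Φ y v)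
  have e3 := hS (fderiv ℝ Φ y v) (fderiv ℝ Φ y (b y)) (fderiv ℝ Φ y w)
  have e4 := hS (fderiv ℝ Φ y w) (fderiv ℝ Φ y (b y)) (fderiv ℝ Φ y v)
  have e5 := hS (fderiv ℝ Φ y (b y)) (fderiv ℝ Φ y w) (fderiv ℝ Φ y v)
  have e6 := hGsymm (Φ y) (fderiv ℝ (fderiv ℝ Φ) y (b y) w) (fderiv ℝ Φ y v)
  have e7 := hGsymm (Φ y) (fderiv ℝ Φ y (fderiv ℝ b y w)) (fderiv ℝ Φ y v)
  have e8 := hGsymm (Φ y) T (fderiv ℝ Φ y v)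
  have e9 := hGsymm (Φ y) T (fderiv ℝ Φ y w)
  have e10 := hGsymm (Φ y) (fderiv ℝ Φ y (b y)) (fderiv ℝ Φ y v)
  have e11 := hGsymm (Φ y) (fderiv ℝ Φ y (b y)) (fderiv ℝ Φ y w)
  linear_combination (fderiv ℝ m y v) * n1 + (fderiv ℝ m y w) * n2 + (2⁻¹ * m y) * e1 + (2⁻¹ * m y) * e2 -
    (2⁻¹ * m y) * e3 - (2⁻¹ * m y) * e4 - (2⁻¹ * m y) * e5 - m y * e6 - m y * e7

end Killing

end KerrCap

/-- **Registered export of this file** (sub-goal `cap_farKilling` of stub `stub_capFarK`): the Killing form of the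
second fundamental form in a chart, `KerrCap.secondFundamentalForm_add_swap_eq`, for maps from chart domains of
`E3` into chart domains of `E4`. [cite: Wald1984, (10.2.13)] -/
theorem cap_farKilling : ∀ {V : Opens E4} {U : Opens E3} {g : PseudoRiemannianMetric 𝓘(ℝ, E4) ∞ E4 (TangentSpace 𝓘(ℝ, E4) : V → Type _)} {G : E4 → E4 →L[ℝ] E4 →L[ℝ] ℝ} [g.HasLeviCivita], (∀ x : V, g.val x = G x) → (∀ x (X Y : E4), G x X Y = G x Y X) → ∀ {f : U → V} {Φ : E3 → E4}, (∀ y : U, (f y : E4) = Φ y) → ∀ {ν : NormalField 𝓘(ℝ, E4) f} {N : E3 → E4}, (∀ y : U, ν y = N y) → ∀ {y : U} {T : E4} {m : E3 → ℝ} {b : E3 → E3}, ContDiffAt ℝ 2 Φ y → DifferentiableAt ℝ m y → DifferentiableAt ℝ b y → (N =ᶠ[𝓝 (y : E3)] fun z ↦ m z • (T - fderiv ℝ Φ z (b z))) → DifferentiableAt ℝ G (Φ y) → fderiv ℝ G (Φ y) T = 0 → (∀ w : E3, G (Φ y) (T - fderiv ℝ Φ y (b y)) (fderiv ℝ Φ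 y w) = 0) → ∀ (v w : E3), g.secondFundamentalForm 𝓘(ℝ, E3) f ν y v w + g.secondFundamentalForm 𝓘(ℝ, E3) f ν y w v = -(m y * (fderiv ℝ (fun z ↦ G (Φ z) (fderiv ℝ Φ z v) (fderiv ℝ Φ z w)) y (b y) + G (Φ y) (fderiv ℝ Φ y (fderiv ℝ b y v)) (fderiv ℝ Φ y w) + G (Φ y) (fderiv ℝ Φ y v) (fderiv ℝ Φ y (fderiv ℝ b y w)))) :=
  fun hG hGsymm _ _ hf _ _ hν _ _ _ _ hΦ hm hb hN hGd hT hnormal v w ↦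
    KerrCap.secondFundamentalForm_add_swap_eq hG hGsymm hf hν hΦ hm hb hN hGd hT hnormal v w

end Summit.FinalStateConjecture.FinalStateConjecture.Theorems.SwallowTheDatum

end
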